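import Summits.AtomisticToContinuum.FouriersLaw.Theses.OddSectorIrreversibility
import Literature.MathematicalPhysics.KineticTheory.LangevinChainHormander

/-!
# `OddDensityIsCorrector`, part 1: the weak adjoint equation of the response density

Helper file for support item `stmt-AtomisticToContinuum-9146`
(`OddSectorIrreversibility.OddDensityIsCorrector`, McLennan / Kundu–Dhar–Narayan identity).

Differentiating the weak stationarity `∫ L_{T+δ/2, T-δ/2} F dμ_δ = 0` of a steady-state family at
`δ = 0` against the linear-response density `h` of the family (difference quotients of `∫ F dμ_δ`
converge to `∫ F h dμ₀` for `F ∈ C_c^∞`) gives, for `N ≥ 2` and every `F ∈ C_c^∞`,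

  `∫ (L_{T,T} F) h dμ₀ = -(γ/2) ∫ (∂²_{p_0} F - ∂²_{p_{N-1}} F) dμ₀`

(`integral_generator_mul_responseDensity`): the generator is affine in the bath temperatures
(`generator_temp_split`), `L F` and `∂²_{p_b} F` are again test functions, and limits along `𝓝[≠] 0`
are unique. When `μ₀` is the Gibbs measure `μ_T`, two Gaussian integrations by parts in `p_b`
(`integral_partialP_partialP_gibbsMeasure`: `∫ ∂²_{p_b}F dμ_T = T⁻² ∫ F (p_b² - T) dμ_T`) turn the
right-hand side into `-∫ F g dμ_T` with the McLennan source `g = γ (p_0² - p_{N-1}²)/(2T²)`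
(`integral_generator_mul_responseDensity_gibbs`). Nothing here closes an item.
-/

noncomputable section

open MeasureTheory Filter Topology Set
open scoped ContDiff
open Literature.MathematicalPhysics.KineticTheory.HeatConduction

namespace Summit.AtomisticToContinuum.FouriersLaw.Theorems.OddSectorIrreversibility

variable {N : ℕ}

/-! ### The generator is affine in the bath temperatures -/

/-- `L_{T+a, T+b} f = L_{T,T} f + γ ∑_i ([i = 0] a + [i = N-1] b) ∂²_{p_i} f` pointwise, for every
chain and every `f` (the temperatures enter only through `γ T_b ∂²_{p_b}`). [folklore] -/
theorem generator_temp_split (P : OscillatorChain) (N : ℕ) (T a b : ℝ) (f : PhaseSpace N → ℝ)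
    (x : PhaseSpace N) :
    P.generator N (T + a) (T + b) f x = P.generator N T T f x +
      P.γ * ∑ i : Fin N, ((if i.val = 0 then a * partialP i (partialP i f) x else 0) +
        (if i.val = N - 1 then b * partialP i (partialP i f) x else 0)) := by
  unfold OscillatorChain.generator
  rw [add_assoc, ← mul_add, ← Finset.sum_add_distrib]
  congr 2
  refine Finset.sum_congr rfl fun i _ => ?_
  split_ifs <;> ring

/-- For `N ≥ 2` the bath sum collapses to the two end sites:
`∑_i ([i = 0] a ∂²_{p_i} f + [i = N-1] b ∂²_{p_i} f) = a ∂²_{p_0} f + b ∂²_{p_{N-1}} f`. [folklore] -/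
theorem sum_bath_two (hN : 2 ≤ N) (a b : ℝ) (f : PhaseSpace N → ℝ) (x : PhaseSpace N) :
    (∑ i : Fin N, ((if i.val = 0 then a * partialP i (partialP i f) x else 0) +
        (if i.val = N - 1 then b * partialP i (partialP i f) x else 0))) =
      a * partialP ⟨0, by omega⟩ (partialP ⟨0, by omega⟩ f) x +
        b * partialP ⟨N - 1, by omega⟩ (partialP ⟨N - 1, by omega⟩ f) x := by
  rw [Finset.sum_add_distrib]
  congr 1
  · rw [Finset.sum_eq_single ⟨0, by omega⟩]
    · simp
    · intro i _ hi
      rw [if_neg]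
      exact fun h0 => hi (Fin.ext h0)
    · intro h; exact absurd (Finset.mem_univ _) h
  · rw [Finset.sum_eq_single ⟨N - 1, by omega⟩]
    · simp
    · intro i _ hi
      rw [if_neg]
      exact fun h0 => hi (Fin.ext h0)
    · intro h; exact absurd (Finset.mem_univ _) h

/-! ### Test functions are stable under `L` and `∂²_{p_b}` -/

/-- For smooth potentials and `f ∈ C^∞`, `L f ∈ C^∞` (`L f = Df·Y + γ ∑ c_i ∂²_{p_i} f`). [folklore] -/
theorem contDiff_generator (P : OscillatorChain) (hU : ContDiff ℝ ∞ P.U) (hV : ContDiff ℝ ∞ P.V)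
    (N : ℕ) (T_L T_R : ℝ) {f : PhaseSpace N → ℝ} (hf : ContDiff ℝ ∞ f) :
    ContDiff ℝ ∞ (P.generator N T_L T_R f) := by
  have hfd : Differentiable ℝ f := hf.differentiable (by simp)
  have h : P.generator N T_L T_R f = fun x => fderiv ℝ f x (P.drift N x) +
      P.γ * ∑ i, ((if i.val = 0 then T_L else 0) + (if i.val = N - 1 then T_R else 0)) *
        partialP i (partialP i f) x :=
    funext fun x => P.generator_eq_fderiv_drift_add N T_L T_R hfd x
  rw [h]
  have hP1 : ∀ i, ContDiff ℝ ∞ (partialP i f) := fun i =>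
    contDiff_partialP hf (m := ∞) (by exact_mod_cast le_top) i
  have hP2 : ∀ i, ContDiff ℝ ∞ (partialP i (partialP i f)) := fun i =>
    contDiff_partialP (hP1 i) (m := ∞) (by exact_mod_cast le_top) i
  refine ContDiff.add ?_ (contDiff_const.mul (ContDiff.sum fun i _ => contDiff_const.mul (hP2 i)))
  exact (hf.fderiv_right (m := ∞) (by exact_mod_cast le_top)).clm_apply (P.contDiff_drift hU hV N)

/-- `∂²_{p_b} f` is smooth and compactly supported for a test function `f`. [folklore] -/
theorem contDiff_hasCompactSupport_partialP_partialP {f : PhaseSpace N → ℝ} (hf : ContDiff ℝ ∞ f)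
    (hfc : HasCompactSupport f) (i : Fin N) :
    ContDiff ℝ ∞ (partialP i (partialP i f)) ∧ HasCompactSupport (partialP i (partialP i f)) := by
  have hP1 : ContDiff ℝ ∞ (partialP i f) := contDiff_partialP hf (m := ∞) (by exact_mod_cast le_top) i
  refine ⟨contDiff_partialP hP1 (m := ∞) (by exact_mod_cast le_top) i, ?_⟩
  exact hasCompactSupport_partialP (hP1.differentiable (by simp))
    (hasCompactSupport_partialP (hf.differentiable (by simp)) hfc i) i

/-- A continuous compactly supported function is integrable for every finite measure. [folklore] -/
theorem integrable_of_continuous_hasCompactSupport {f : PhaseSpace N → ℝ} (hf : Continuous f)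
    (hfc : HasCompactSupport f) (μ : Measure (PhaseSpace N)) [IsFiniteMeasure μ] : Integrable f μ := by
  obtain ⟨C, hC⟩ := hf.bounded_above_of_compact_support hfc
  exact (integrable_const C).mono' hf.aestronglyMeasurable (Eventually.of_forall hC)

/-! ### The weak adjoint equation of the response density -/

/-- **Differentiating weak stationarity.** Let `μ N T_L T_R` be weak steady states of the pinned
chain for all `T_L, T_R > 0`, `N ≥ 2`, `T > 0`, and let `h` be a linear-response density of the
family `δ ↦ μ_{N, T+δ/2, T-δ/2}` at `δ = 0` on test functions
(`(∫ F dμ_δ - ∫ F dμ₀)/δ → ∫ F h dμ₀` along `𝓝[≠] 0`, `μ₀ = μ N T T`). Then for every `F ∈ C_c^∞`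
`∫ (L_{T,T} F) h dμ₀ = -(γ/2) ∫ (∂²_{p_0}F - ∂²_{p_{N-1}}F) dμ₀`: apply stationarity of `μ_δ` to
`F`, split `L_{T+δ/2,T-δ/2} = L_{T,T} + (γδ/2)(∂²_{p_0} - ∂²_{p_{N-1}})`, divide by `δ` and let
`δ → 0` (the response hypothesis at `L F` and at `(∂²_{p_0} - ∂²_{p_{N-1}})F`).
[cite: KunduDharNarayan2009, eq. (reln2)] -/
theorem integral_generator_mul_responseDensity {ω₂ lam β γ : ℝ} (hN : 2 ≤ N) {T : ℝ} (hT : 0 < T)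
    (μ : (N : ℕ) → ℝ → ℝ → Measure (PhaseSpace N))
    (hμ : ∀ (N : ℕ) (T_L T_R : ℝ), 0 < T_L → 0 < T_R →
      (pinnedChain ω₂ lam β γ).IsSteadyState N T_L T_R (μ N T_L T_R))
    {h : PhaseSpace N → ℝ}
    (hresp : ∀ F : PhaseSpace N → ℝ, ContDiff ℝ ∞ F → HasCompactSupport F →
      Tendsto (fun δ : ℝ => ((∫ x, F x ∂(μ N (T + δ / 2) (T - δ / 2))) - ∫ x, F x ∂(μ N T T)) / δ)
        (𝓝[≠] 0) (𝓝 (∫ x, F x * h x ∂(μ N T T))))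
    {F : PhaseSpace N → ℝ} (hF : ContDiff ℝ ∞ F) (hFc : HasCompactSupport F) :
    ∫ x, (pinnedChain ω₂ lam β γ).generator N T T F x * h x ∂(μ N T T) =
      -(γ / 2) * ∫ x, (partialP ⟨0, by omega⟩ (partialP ⟨0, by omega⟩ F) x -
        partialP ⟨N - 1, by omega⟩ (partialP ⟨N - 1, by omega⟩ F) x) ∂(μ N T T) := by
  set P := pinnedChain ω₂ lam β γ with hP
  have hγ' : P.γ = γ := rfl
  set b₀ : Fin N := ⟨0, by omega⟩ with hb₀
  set b₁ : Fin N := ⟨N - 1, by omega⟩ with hb₁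
  set LF : PhaseSpace N → ℝ := P.generator N T T F with hLF
  set G : PhaseSpace N → ℝ := fun x => partialP b₀ (partialP b₀ F) x - partialP b₁ (partialP b₁ F) x
    with hG
  -- the two test functions
  have hLs : ContDiff ℝ ∞ LF :=
    contDiff_generator P (pinnedChain_contDiff_U ω₂ lam β γ) (pinnedChain_contDiff_V ω₂ lam β γ) N T T hF
  have hLc : HasCompactSupport LF := P.hasCompactSupport_generator N T T (hF.of_le (by norm_cast)) hFc
  have h0 := contDiff_hasCompactSupport_partialP_partialP hF hFc b₀
  have h1 := contDiff_hasCompactSupport_partialP_partialP hF hFc b₁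
  have hGs : ContDiff ℝ ∞ G := h0.1.sub h1.1
  have hGc : HasCompactSupport G := h0.2.sub h1.2
  -- stationarity at `δ = 0`
  have hst0 : ∫ x, LF x ∂(μ N T T) = 0 := (hμ N T T hT hT).2.1 F hF hFc
  -- the identity `(∫ LF dμ_δ - ∫ LF dμ₀)/δ = -(γ/2) ∫ G dμ_δ` for `0 < |δ| < 2T`
  have key : ∀ᶠ δ in 𝓝[≠] (0 : ℝ),
      ((∫ x, LF x ∂(μ N (T + δ / 2) (T - δ / 2))) - ∫ x, LF x ∂(μ N T T)) / δ =
        -(γ / 2) * ∫ x, G x ∂(μ N (T + δ / 2) (T - δ / 2)) := by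
    have h2 : ∀ᶠ δ in 𝓝 (0 : ℝ), δ < 2 * T := eventually_lt_nhds (by linarith)
    have h2' : ∀ᶠ δ in 𝓝 (0 : ℝ), -(2 * T) < δ := eventually_gt_nhds (by linarith)
    filter_upwards [mem_nhdsWithin_of_mem_nhds h2, mem_nhdsWithin_of_mem_nhds h2',
      self_mem_nhdsWithin] with δ hlt hgt hne
    have ha : 0 < T + δ / 2 := by linarith
    have hb : 0 < T - δ / 2 := by linarith
    set ν := μ N (T + δ / 2) (T - δ / 2) with hν
    haveI : IsProbabilityMeasure ν := (hμ N _ _ ha hb).1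
    have hst : ∫ x, P.generator N (T + δ / 2) (T - δ / 2) F x ∂ν = 0 := (hμ N _ _ ha hb).2.1 F hF hFc
    have hsplit : ∀ x, P.generator N (T + δ / 2) (T - δ / 2) F x = LF x + (γ * δ / 2) * G x := by
      intro x
      have := generator_temp_split P N T (δ / 2) (-(δ / 2)) F x
      rw [show T + -(δ / 2) = T - δ / 2 by ring] at this
      rw [this, sum_bath_two hN, hγ']
      simp only [hLF, hG, hb₀, hb₁]
      ring
    simp_rw [hsplit] at hst
    have hiL : Integrable LF ν := integrable_of_continuous_hasCompactSupport hLs.continuous hLc ν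
    have hiG : Integrable G ν := integrable_of_continuous_hasCompactSupport hGs.continuous hGc ν
    rw [integral_add hiL (hiG.const_mul _), integral_const_mul] at hst
    rw [hst0, sub_zero]
    have hne' : (δ : ℝ) ≠ 0 := hne
    field_simp
    linarith
  -- response at `LF`
  have hA : Tendsto (fun δ : ℝ => -(γ / 2) * ∫ x, G x ∂(μ N (T + δ / 2) (T - δ / 2))) (𝓝[≠] 0)
      (𝓝 (∫ x, LF x * h x ∂(μ N T T))) := (hresp LF hLs hLc).congr' key
  -- response at `G`: `∫ G dμ_δ → ∫ G dμ₀`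
  have hB : Tendsto (fun δ : ℝ => ∫ x, G x ∂(μ N (T + δ / 2) (T - δ / 2))) (𝓝[≠] 0)
      (𝓝 (∫ x, G x ∂(μ N T T))) := by
    have hq := hresp G hGs hGc
    have hδ : Tendsto (fun δ : ℝ => δ) (𝓝[≠] (0 : ℝ)) (𝓝 0) :=
      tendsto_id.mono_left nhdsWithin_le_nhds
    have hprod := hδ.mul hq
    rw [zero_mul] at hprod
    have hsum := hprod.add_const (∫ x, G x ∂(μ N T T))
    rw [zero_add] at hsum
    refine hsum.congr' ?_
    filter_upwards [self_mem_nhdsWithin] with δ hne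
    have hne' : (δ : ℝ) ≠ 0 := hne
    field_simp
    ring
  have hB' := hB.const_mul (-(γ / 2))
  exact tendsto_nhds_unique hA hB'

/-! ### Gaussian integration by parts under the Gibbs measure -/

/-- `∫ p_b ∂_{p_b} f e^{-H/T} = T⁻¹ ∫ f (p_b² - T) e^{-H/T}` for `f ∈ C¹_c`
(`∂_{p_b} (p_b e^{-H/T}) = (1 - p_b²/T) e^{-H/T}`). [folklore] -/
theorem integral_momentum_partialP_mul_gibbsDensity (P : OscillatorChain) (hU : Continuous P.U)
    (hV : Continuous P.V) (N : ℕ) {T : ℝ} (hT : T ≠ 0) {f : PhaseSpace N → ℝ} (hf : ContDiff ℝ 1 f)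
    (hfc : HasCompactSupport f) (i : Fin N) :
    ∫ x, x.2 i * partialP i f x * P.gibbsDensity N T x =
      T⁻¹ * ∫ x, f x * (x.2 i ^ 2 - T) * P.gibbsDensity N T x := by
  have hfd : Differentiable ℝ f := hf.differentiable one_ne_zero
  have hρc : Continuous (P.gibbsDensity N T) := P.continuous_gibbsDensity hU hV N T
  have hpc : Continuous fun x : PhaseSpace N => x.2 i := (continuous_apply i).comp continuous_snd
  -- `∂_{p_i} (p_i ρ) = ρ - (p_i²/T) ρ`
  have hline : ∀ x : PhaseSpace N, HasLineDerivAt ℝ (fun y : PhaseSpace N => y.2 i * P.gibbsDensity N T y)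
      (P.gibbsDensity N T x + x.2 i * (-(x.2 i / T) * P.gibbsDensity N T x)) x
      ((0, Pi.single i 1) : PhaseSpace N) := by
    intro x
    have hρ' := P.hasLineDerivAt_gibbsDensity (T := T) (P.hasLineDerivAt_hamiltonian_unitP N x i)
    have hp' : HasLineDerivAt ℝ (fun y : PhaseSpace N => y.2 i) 1 x ((0, Pi.single i 1) : PhaseSpace N) := by
      unfold HasLineDerivAt
      have : (fun t : ℝ => (x + t • ((0, Pi.single i 1) : PhaseSpace N)).2 i) = fun t => x.2 i + t := by
        funext t; simp
      rw [this]
      exact (hasDerivAt_id' (0 : ℝ)).const_add (x.2 i) |>.congr_deriv (by simp)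
    unfold HasLineDerivAt at hρ' hp' ⊢
    have := hp'.mul hρ'
    simp only [zero_smul, add_zero, one_mul] at this
    exact this
  have e := integral_mul_eq_neg_of_hasLineDerivAt (v := ((0, Pi.single i 1) : PhaseSpace N))
    (F := fun y : PhaseSpace N => y.2 i * P.gibbsDensity N T y)
    (F' := fun x => P.gibbsDensity N T x + x.2 i * (-(x.2 i / T) * P.gibbsDensity N T x))
    (g := f) (g' := partialP i f) (by fun_prop) (by fun_prop) hf.continuous
    (continuous_partialP hf one_ne_zero i) hfc (hasCompactSupport_partialP hfd hfc i) hline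
    (fun x => hasLineDerivAt_partialP hfd i x)
  have e1 : ∫ x, x.2 i * partialP i f x * P.gibbsDensity N T x =
      ∫ x, (x.2 i * P.gibbsDensity N T x) * partialP i f x :=
    integral_congr_ae (Eventually.of_forall fun x => by ring)
  rw [e1, e, ← integral_neg, ← integral_const_mul]
  refine integral_congr_ae (Eventually.of_forall fun x => ?_)
  field_simp
  ring

/-- **Two Gaussian integrations by parts**: `∫ ∂²_{p_b} f dμ_T = T⁻² ∫ f (p_b² - T) dμ_T` for the
Gibbs measure `μ_T` of a chain with `C¹` potentials and `f ∈ C²_c`. [folklore] -/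
theorem integral_partialP_partialP_gibbsMeasure (P : OscillatorChain) (hU : ContDiff ℝ 1 P.U)
    (hV : ContDiff ℝ 1 P.V) (N : ℕ) {T : ℝ} (hT : T ≠ 0) {f : PhaseSpace N → ℝ} (hf : ContDiff ℝ 2 f)
    (hfc : HasCompactSupport f) (i : Fin N) :
    ∫ x, partialP i (partialP i f) x ∂(P.gibbsMeasure N T) =
      T⁻¹ ^ 2 * ∫ x, f x * (x.2 i ^ 2 - T) ∂(P.gibbsMeasure N T) := by
  -- one integration by parts: `∫ (T ∂² f - p ∂ f) ρ = 0`
  have h1 := P.integral_bath_mul_gibbsDensity hU hV N T T hf hfc i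
  rw [div_self hT, sub_self, zero_mul] at h1
  have hfd : Differentiable ℝ f := hf.differentiable two_ne_zero
  have hg : ContDiff ℝ 1 (partialP i f) := contDiff_partialP hf (by norm_num) i
  have hρc : Continuous (P.gibbsDensity N T) := P.continuous_gibbsDensity hU.continuous hV.continuous N T
  have hgc : HasCompactSupport (partialP i f) := hasCompactSupport_partialP hfd hfc i
  have hg'c : HasCompactSupport (partialP i (partialP i f)) :=
    hasCompactSupport_partialP (hg.differentiable one_ne_zero) hgc i
  have iA : Integrable (fun x => T * partialP i (partialP i f) x * P.gibbsDensity N T x) :=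
    ((continuous_const.mul (continuous_partialP hg one_ne_zero i)).mul hρc).integrable_of_hasCompactSupport
      (hg'c.mul_left.mul_right)
  have iB : Integrable (fun x => x.2 i * partialP i f x * P.gibbsDensity N T x) :=
    ((((continuous_apply i).comp continuous_snd).mul hg.continuous).mul hρc).integrable_of_hasCompactSupport
      (hgc.mul_left.mul_right)
  have hsplit : (fun x => (T * partialP i (partialP i f) x - x.2 i * partialP i f x) * P.gibbsDensity N T x) =
      fun x => T * partialP i (partialP i f) x * P.gibbsDensity N T x -
        x.2 i * partialP i f x * P.gibbsDensity N T x := by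
    funext x; ring
  rw [hsplit, integral_sub iA iB, sub_eq_zero] at h1
  have h1' : ∫ x, partialP i (partialP i f) x * P.gibbsDensity N T x =
      T⁻¹ * ∫ x, x.2 i * partialP i f x * P.gibbsDensity N T x := by
    have : ∫ x, T * partialP i (partialP i f) x * P.gibbsDensity N T x =
        T * ∫ x, partialP i (partialP i f) x * P.gibbsDensity N T x := by
      rw [← integral_const_mul]
      exact integral_congr_ae (Eventually.of_forall fun x => by ring)
    rw [this] at h1
    rw [← h1, ← mul_assoc, inv_mul_cancel₀ hT, one_mul]
  -- second integration by parts
  have h2 := integral_momentum_partialP_mul_gibbsDensity P hU.continuous hV.continuous N hT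
    (hf.of_le (by norm_num)) hfc i
  rw [P.integral_gibbsMeasure, P.integral_gibbsMeasure, h1', h2]
  ring

/-- **The weak adjoint equation of the response density, Gibbs form.** Under the hypotheses of
`integral_generator_mul_responseDensity`, if moreover `μ N T T` is the Gibbs measure `μ_T` of the
pinned chain (e.g. under weak-NESS uniqueness), then for every `F ∈ C_c^∞`
`∫ (L_{T,T} F) h dμ_T = -∫ F g dμ_T` with the McLennan source
`g(q,p) = γ (p_0² - p_{N-1}²) / (2T²)` (formally `L†h = -g`).
[cite: KunduDharNarayan2009, eq. (reln2)] [cite: MaesNetocny2010, Thm 3.1] -/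
theorem integral_generator_mul_responseDensity_gibbs {ω₂ lam β γ : ℝ} (hN : 2 ≤ N) {T : ℝ} (hT : 0 < T)
    (μ : (N : ℕ) → ℝ → ℝ → Measure (PhaseSpace N))
    (hμ : ∀ (N : ℕ) (T_L T_R : ℝ), 0 < T_L → 0 < T_R →
      (pinnedChain ω₂ lam β γ).IsSteadyState N T_L T_R (μ N T_L T_R))
    (hG : μ N T T = (pinnedChain ω₂ lam β γ).gibbsMeasure N T)
    {h : PhaseSpace N → ℝ}
    (hresp : ∀ F : PhaseSpace N → ℝ, ContDiff ℝ ∞ F → HasCompactSupport F →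
      Tendsto (fun δ : ℝ => ((∫ x, F x ∂(μ N (T + δ / 2) (T - δ / 2))) - ∫ x, F x ∂(μ N T T)) / δ)
        (𝓝[≠] 0) (𝓝 (∫ x, F x * h x ∂(μ N T T))))
    {F : PhaseSpace N → ℝ} (hF : ContDiff ℝ ∞ F) (hFc : HasCompactSupport F) :
    ∫ x, (pinnedChain ω₂ lam β γ).generator N T T F x * h x ∂((pinnedChain ω₂ lam β γ).gibbsMeasure N T) =
      -∫ x, F x * (γ / (2 * T ^ 2) * (x.2 ⟨0, by omega⟩ ^ 2 - x.2 ⟨N - 1, by omega⟩ ^ 2))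
        ∂((pinnedChain ω₂ lam β γ).gibbsMeasure N T) := by
  set P := pinnedChain ω₂ lam β γ with hP
  have key := integral_generator_mul_responseDensity hN hT μ hμ hresp hF hFc
  rw [hG] at key
  rw [key]
  have hU : ContDiff ℝ 1 P.U := pinnedChain_contDiff_U ω₂ lam β γ
  have hV : ContDiff ℝ 1 P.V := pinnedChain_contDiff_V ω₂ lam β γ
  have hf2 : ContDiff ℝ 2 F := hF.of_le (by norm_cast)
  haveI : IsProbabilityMeasure (P.gibbsMeasure N T) := by
    rw [← hG]; exact (hμ N T T hT hT).1
  have hfd : Differentiable ℝ F := hF.differentiable (by simp)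
  have hi : ∀ i : Fin N, Integrable (partialP i (partialP i F)) (P.gibbsMeasure N T) := fun i =>
    integrable_of_continuous_hasCompactSupport (contDiff_hasCompactSupport_partialP_partialP hF hFc i).1.continuous
      (contDiff_hasCompactSupport_partialP_partialP hF hFc i).2 _
  have hc0 : Continuous fun x : PhaseSpace N => F x * (x.2 ⟨0, by omega⟩ ^ 2 - T) :=
    hF.continuous.mul ((((continuous_apply (⟨0, by omega⟩ : Fin N)).comp continuous_snd).pow 2).sub
      continuous_const)
  have hc1 : Continuous fun x : PhaseSpace N => F x * (x.2 ⟨N - 1, by omega⟩ ^ 2 - T) :=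
    hF.continuous.mul ((((continuous_apply (⟨N - 1, by omega⟩ : Fin N)).comp continuous_snd).pow 2).sub
      continuous_const)
  have i0 : Integrable (fun x : PhaseSpace N => F x * (x.2 ⟨0, by omega⟩ ^ 2 - T)) (P.gibbsMeasure N T) :=
    integrable_of_continuous_hasCompactSupport hc0 hFc.mul_right _
  have i1 : Integrable (fun x : PhaseSpace N => F x * (x.2 ⟨N - 1, by omega⟩ ^ 2 - T)) (P.gibbsMeasure N T) :=
    integrable_of_continuous_hasCompactSupport hc1 hFc.mul_right _
  have eR : ∫ x, F x * (γ / (2 * T ^ 2) * (x.2 ⟨0, by omega⟩ ^ 2 - x.2 ⟨N - 1, by omega⟩ ^ 2))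
      ∂(P.gibbsMeasure N T) = γ / (2 * T ^ 2) *
        ((∫ x, F x * (x.2 ⟨0, by omega⟩ ^ 2 - T) ∂(P.gibbsMeasure N T)) -
          ∫ x, F x * (x.2 ⟨N - 1, by omega⟩ ^ 2 - T) ∂(P.gibbsMeasure N T)) := by
    rw [← integral_sub i0 i1, ← integral_const_mul]
    refine integral_congr_ae (Eventually.of_forall fun x => ?_)
    ring
  rw [integral_sub (hi _) (hi _), integral_partialP_partialP_gibbsMeasure P hU hV N hT.ne' hf2 hFc,
    integral_partialP_partialP_gibbsMeasure P hU hV N hT.ne' hf2 hFc, eR]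
  field_simp

end Summit.AtomisticToContinuum.FouriersLaw.Theorems.OddSectorIrreversibility

end
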